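import Summits.Ventures.CertifiedManyBodySolver.Upper.DWaveSourceOpenClusterCut
import HarnessLib

/-!
# Closed form of the open-box `d`-wave pair weight `dWaveBoxPairWeight a b`, for EVERY box size

HONEST FRAMING: first certified bounds; not a superconductivity verdict. Nothing in this file is a number or a
row: it is a definitional identity about the finite object of `Upper/DWaveSourceOpenClusterCut.lean`
(seat hubbard-obs-pin-1), written by the IRD desk (sr-mbsolver-ird-5) as the kernel-checked DICTIONARY between
the tree's weight — a sum over the five steps `e ∈ {0, ±e₀, ±e₁}` of `1[q = p + e] ĝ_d(e)/√2` — and the closed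
form every FORMAT-mpsgf1 producer/reader regenerates its pair terms from (sr-mbsolver-var-10 `hamsgf`,
sr-mbsolver-ird-3 `sgf_model`, sr-mbsolver-ird-5 `mpsgf_audit`, sr-mbsolver-var-5 `gf1read`):

* `dWaveBoxPairWeight_eq_closedForm`: `w_C(p,q) = [p ~ q in rectBoxGraph a b] · (±1)/√2`, sign `+` iff the FIRST
  coordinates differ (an x-bond), `−` on a y-bond, `0` on every non-bond pair (in particular no wrap-around bond
  and no diagonal/on-site weight), for all `a b`;
* `dWaveBoxPairWeight_of_not_adj`, `dWaveBoxPairWeight_symm`: the weight vanishes off the box graph and is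
  symmetric in `(p,q)` (both orientations of a bond carry the same weight, as in `pairField = Σ_x localPair`).
-/

noncomputable section
namespace Summit.Ventures.CertifiedManyBodySolver
open Matrix Finset Literature.Probability.LatticeModels
open Literature.MathematicalPhysics.QuantumLattice Literature.Barriers.HubbardSuperconductivity HubbardWave0

section ClosedForm

/-- The five-step sum `Σ_{e ∈ {0, e₀, −e₀, e₁, −e₁}} f e` written out. [folklore] -/
private theorem sum_insert_unitSteps (f : Site 2 → ℂ) :
    ∑ e ∈ insert (0 : Site 2) unitSteps, f e =
      f 0 + (f (Pi.single 0 1) + (f (-Pi.single 0 1) + (f (Pi.single 1 1) + f (-Pi.single 1 1)))) := by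
  have h01 : (Pi.single 0 1 : Site 2) ≠ -Pi.single 0 1 := fun h => by simpa using congrFun h 0
  have h02 : (Pi.single 0 1 : Site 2) ≠ Pi.single 1 1 := fun h => by simpa using congrFun h 0
  have h03 : (Pi.single 0 1 : Site 2) ≠ -Pi.single 1 1 := fun h => by simpa using congrFun h 0
  have h12 : (-Pi.single 0 1 : Site 2) ≠ Pi.single 1 1 := fun h => by simpa using congrFun h 0
  have h13 : (-Pi.single 0 1 : Site 2) ≠ -Pi.single 1 1 := fun h => by simpa using congrFun h 0
  have h23 : (Pi.single 1 1 : Site 2) ≠ -Pi.single 1 1 := fun h => by simpa using congrFun h 1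
  have hz0 : (0 : Site 2) ≠ Pi.single 0 1 := fun h => by simpa using congrFun h 0
  have hz1 : (0 : Site 2) ≠ -Pi.single 0 1 := fun h => by simpa using congrFun h 0
  have hz2 : (0 : Site 2) ≠ Pi.single 1 1 := fun h => by simpa using congrFun h 1
  have hz3 : (0 : Site 2) ≠ -Pi.single 1 1 := fun h => by simpa using congrFun h 1
  simp only [unitSteps]
  rw [Finset.sum_insert (by simp [hz0, hz1, hz2, hz3]), Finset.sum_insert (by simp [h01, h02, h03]),
    Finset.sum_insert (by simp [h12, h13]), Finset.sum_insert (by simp [h23]), Finset.sum_singleton]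

/-- `ĝ_d(e₀) = 1`. -/
private theorem dWaveFormFactor_e0 : dWaveFormFactor (Pi.single 0 1) = 1 := by simp [dWaveFormFactor]
/-- `ĝ_d(−e₀) = 1`. -/
private theorem dWaveFormFactor_neg_e0 : dWaveFormFactor (-Pi.single 0 1) = 1 := by simp [dWaveFormFactor]
/-- `ĝ_d(e₁) = −1`. -/
private theorem dWaveFormFactor_e1 : dWaveFormFactor (Pi.single 1 1) = -1 := by
  have h1 : (Pi.single 1 1 : Site 2) ≠ Pi.single 0 1 := fun h => by simpa using congrFun h 0
  have h2 : (Pi.single 1 1 : Site 2) ≠ -Pi.single 0 1 := fun h => by simpa using congrFun h 0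
  simp [dWaveFormFactor, h1, h2]
/-- `ĝ_d(−e₁) = −1`. -/
private theorem dWaveFormFactor_neg_e1 : dWaveFormFactor (-Pi.single 1 1) = -1 := by
  have h3 : (-Pi.single 1 1 : Site 2) ≠ Pi.single 0 1 := fun h => by simpa using congrFun h 0
  have h4 : (-Pi.single 1 1 : Site 2) ≠ -Pi.single 0 1 := fun h => by simpa using congrFun h 1
  simp [dWaveFormFactor, h3, h4]

/-- **Closed form of the tree's box pair weight** (all `a, b`): `w_C(p,q) = ±1/√2` on `rectBoxGraph` bonds, `+` iff the
first coordinates differ (x-bond), `−` on y-bonds, `0` otherwise — the form FORMAT-mpsgf1 producers and readers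
regenerate the pair terms from (var-10 `openBoxDWaveWeight`). [cite: KomaTasaki1994, §1] -/
theorem dWaveBoxPairWeight_eq_closedForm (a b : ℕ) (p q : Fin a ×ₗ Fin b) :
    dWaveBoxPairWeight a b (p, q) =
      if (rectBoxGraph a b).Adj p q then
        ((((if (ofLex p).1 ≠ (ofLex q).1 then (1 : ℝ) else -1) / Real.sqrt 2 : ℝ)) : ℂ)
      else 0 := by
  unfold dWaveBoxPairWeight
  rw [sum_insert_unitSteps]
  simp only [Pi.zero_apply, add_zero, dWaveFormFactor_zero, zero_div, Complex.ofReal_zero, ite_self,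
    zero_add, Pi.single_eq_same, Pi.neg_apply, dWaveFormFactor_e0, dWaveFormFactor_neg_e0, dWaveFormFactor_e1,
    dWaveFormFactor_neg_e1,
    Pi.single_eq_of_ne (show (1 : Fin 2) ≠ 0 by decide), Pi.single_eq_of_ne (show (0 : Fin 2) ≠ 1 by decide), neg_zero]
  -- now pure arithmetic on the coordinates
  simp only [rectBoxGraph, lineAdj, Fin.ext_iff, ne_eq]
  generalize ((ofLex p).1 : ℕ) = X1
  generalize ((ofLex p).2 : ℕ) = Y1
  generalize ((ofLex q).1 : ℕ) = X2
  generalize ((ofLex q).2 : ℕ) = Y2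
  split_ifs <;> first | (exfalso; omega) | simp

/-- The box pair weight vanishes on every pair that is not a bond of `rectBoxGraph a b` (no wrap-around, no
diagonal, no on-site weight). [cite: KomaTasaki1994, §1] -/
theorem dWaveBoxPairWeight_of_not_adj (a b : ℕ) (p q : Fin a ×ₗ Fin b) (h : ¬ (rectBoxGraph a b).Adj p q) :
    dWaveBoxPairWeight a b (p, q) = 0 := by
  rw [dWaveBoxPairWeight_eq_closedForm, if_neg h]

/-- The box pair weight is symmetric: both orientations of a bond carry the same weight. [cite: KomaTasaki1994, §1] -/
theorem dWaveBoxPairWeight_symm (a b : ℕ) (p q : Fin a ×ₗ Fin b) :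
    dWaveBoxPairWeight a b (p, q) = dWaveBoxPairWeight a b (q, p) := by
  rw [dWaveBoxPairWeight_eq_closedForm, dWaveBoxPairWeight_eq_closedForm]
  by_cases h : (rectBoxGraph a b).Adj p q
  · rw [if_pos h, if_pos h.symm]
    simp only [ne_comm]
  · rw [if_neg h, if_neg (fun h' => h h'.symm)]

/-- **The box graph in the producers' words**: `p ∼ q` in `rectBoxGraph a b` iff the ℓ¹ distance of the integer
coordinates is `1` («nearest-neighbour bonds `|Δx| + |Δy| = 1` inside the box only», FORMAT-mps1 §5 V2 / FORMAT-mpsgf1 §1).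
[folklore] -/
theorem rectBoxGraph_adj_iff_l1 (a b : ℕ) (p q : Fin a ×ₗ Fin b) :
    (rectBoxGraph a b).Adj p q ↔
      (((ofLex p).1 : ℤ) - ((ofLex q).1 : ℤ)).natAbs + (((ofLex p).2 : ℤ) - ((ofLex q).2 : ℤ)).natAbs = 1 := by
  simp only [rectBoxGraph, lineAdj, Fin.ext_iff]
  generalize ((ofLex p).1 : ℕ) = X1
  generalize ((ofLex p).2 : ℕ) = Y1
  generalize ((ofLex q).1 : ℕ) = X2
  generalize ((ofLex q).2 : ℕ) = Y2
  omega

end ClosedForm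
end Summit.Ventures.CertifiedManyBodySolver
end
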